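import Summits.Ventures.YMGap.RobustBall.LocalSourceMassGap
import Summits.Ventures.YMGap.RobustBall.LocalSourceResponseBall
import Summits.Ventures.YMGap.RobustBall.LocalSourceAnalytic
import Summits.Ventures.YMGap.RobustBall.UniformRateStrongCoupling
import HarnessLib

/-!
# Venture YMGap, track ROBUST-BALL (Y2) — THE WILSON POINT WITH LOOPS OF ANY STRENGTH, EVERY `N ≥ 2`: one state, Feynman–Hellmann,
# real-analyticity, exponentially small susceptibility, and a surviving mass gap — at the logarithmic strong-coupling rates

HONEST FRAMING. WHAT THIS IS: a venture file (cell `pub-ymgap`, track Y2 ROBUST-BALL, seat rb-p1, theorems only): the local-source package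
(`LocalSourceOneState`, `LocalSourceLoops`, `LocalSourceResponse[Ball]`, `LocalSourceAnalytic`, `LocalSourceClustering`,
`LocalSourceMassGap`) read at the WILSON POINT of ANY ball carrying the uniform gauge-ball currency with the zero member
(`UniformMassGapOnBallZdG d N β 0 0 0 m A`), as five GENERIC lemmas —
`wilson_loops_hasUniqueGibbsMeasure_of_uniform` (finitely many loops of any strengths ⇒ one DLR state),
`wilson_singleLoop_hasDerivAt_of_uniform` (`d/dt ⟨F⟩_t = −cov_{ν_t}(F, Re tr U_w/N)` on `ℝ`), `wilson_singleLoop_analyticAt_of_uniform`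
(`t ↦ ⟨F⟩_t` real-analytic on `ℝ`), `wilson_singleLoop_susceptibility_le_of_uniform` (`|χ| ≤ A n² e^{−m d(Λ_F, w)} (…)`),
`wilson_singleLoop_massGap_of_uniform` (the perturbed state clusters between ANY two Lipschitz cylinders at rate `m/2`, constant
`A n² e^{2|t|} e^{m|w|} (…)`) — and then INSTANTIATED at the logarithmic strong-coupling rates of `UniformRateStrongCoupling.lean`:
* EVERY `N ≥ 2`, `d = 4`, 't Hooft coupling `0 < β < 1/64` (hypothesis-free Bakry–Émery door): `suN_wilson_uniformMassGapOnBallZdG_rate`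
  (`m = log(1/(64β))`, `A = 8N`), `suN_wilson_loops_hasUniqueGibbsMeasure`, `suN_wilson_singleLoop_hasDerivAt`,
  `suN_wilson_singleLoop_analyticAt`, `suN_wilson_singleLoop_susceptibility_le`, `suN_wilson_twoLoop_response_le` (the response of one loop to another
  decays like `(64β)^{d(w₁,w₂)}`), `suN_wilson_singleLoop_massGap`;
* `SU(2)`, `d = 4`, `0 < β_W < 1/8` at rate `log(1/(8β_W))`, constant `16`: `su2_wilson_uniformMassGapOnBallZdG_rate`,
  `su2_wilson_singleLoop_susceptibility_le_rate`, `su2_wilson_singleLoop_massGap_rate`.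
WHAT THIS IS NOT: the rates are Dobrushin-comparison lower bounds on the inverse correlation length (not the physical mass), `m/2` after a
local source is bookkeeping; lattice strong coupling only; nothing about the continuum limit or a Clay-sense mass gap.
-/

noncomputable section

open MeasureTheory Function Finset Real ProbabilityTheory
open scoped NNReal
open Literature.Probability.LatticeModels
open Literature.MathematicalPhysics.QuantumLattice
open Literature.MathematicalPhysics.QuantumFieldTheory hiding ZdEdge Site

namespace Summit.Ventures.YMGap.RobustBall

variable {d N : ℕ}

/-! ### Generic: the Wilson point of a ball with the uniform gauge-ball currency, plus loops of any strength -/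

section Generic

variable {β m A : ℝ} {ι' : Type*}

/-- The data of the one-loop source `γ ≡ ⟨x, w⟩` with coupling `t`, as a tier-1 member, and its catalogue. -/
private theorem singleLoop_data {x : Literature.Probability.LatticeModels.Site d} (w : (zdGraph d).Walk x x) (t : ℝ) :
    (loopFamilyAction (d := d) N (fun _ : Unit => (⟨x, w⟩ : ZdLoop d)) fun _ => t).IsAdapted ∧
    (∀ X, ∃ C, ∀ U, |loopFamilyAction (d := d) N (fun _ : Unit => (⟨x, w⟩ : ZdLoop d)) (fun _ => t) X U| ≤ C) ∧
    (loopFamilyAction (d := d) N (fun _ : Unit => (⟨x, w⟩ : ZdLoop d)) fun _ => t).IsSupportedBy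
      (loopSupp (fun _ : Unit => (⟨x, w⟩ : ZdLoop d))) ∧
    (∀ Λ, loopSupp (fun _ : Unit => (⟨x, w⟩ : ZdLoop d)) Λ ⊆
      (Finset.univ : Finset Unit).image fun i => walkEdges ((fun _ : Unit => (⟨x, w⟩ : ZdLoop d)) i).walk) := by
  classical
  have hV := memBallZd_loopFamilyAction_fintype (N := N) (fun _ : Unit => (⟨x, w⟩ : ZdLoop d)) fun _ => t
  exact ⟨fun X => ⟨hV.dependsOn X, (hV.continuous X).measurable⟩, fun X => exists_bound_of_continuous (hV.continuous X),
    hV.supportedBy, fun Λ => Finset.image_subset_image (Finset.subset_univ _)⟩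

/-- The catalogue of the one-loop source is `{links of w}`. -/
private theorem singleLoop_image {x : Literature.Probability.LatticeModels.Site d} (w : (zdGraph d).Walk x x) :
    (Finset.univ : Finset Unit).image (fun i => walkEdges ((fun _ : Unit => (⟨x, w⟩ : ZdLoop d)) i).walk) = {walkEdges w} := by
  classical
  ext X
  simp only [Finset.mem_image, Finset.mem_univ, true_and, Finset.mem_singleton]
  exact ⟨fun ⟨_, h⟩ => h.symm, fun h => ⟨(), h.symm⟩⟩

/-- **FINITELY MANY LOOPS OF ANY STRENGTHS CREATE NO PHASE AT THE WILSON POINT** of a ball with `UniformMassGapOnBallZdG d N β 0 0 0 m A`: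
for every finite loop family `γ'` and all real couplings `c'`, the Wilson action plus `Σ_j c'_j Re tr U_{γ'_j}/N` has exactly one DLR state. -/
theorem wilson_loops_hasUniqueGibbsMeasure_of_uniform (hball : UniformMassGapOnBallZdG d N β 0 0 0 m A) [Fintype ι']
    (γ' : ι' → ZdLoop d) (c' : ι' → ℝ) :
    HasUniqueGibbsMeasure (perturbedYM (d := d) (fundamentalRep (Fin N)) (N * β) (loopFamilyAction (d := d) N γ' c') (loopSupp γ')) := by
  have hmem : MemBallZdG (N := N) (d := d) 0 0 0 0 (fun _ => (∅ : Finset (Finset (ZdEdge d)))) := memBallZdG_zero le_rfl le_rfl 0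
  have key := hasUniqueGibbsMeasure_add_loops_of_uniformMassGapOnBallZdG hball hmem γ' c'
  simpa only [zero_add, Finset.empty_union] using key

/-- **FEYNMAN–HELLMANN AT THE WILSON POINT, ONE LOOP OF ANY STRENGTH**: for every selection `ν t` of DLR states of the Wilson action with
`t · Re tr U_w/N` inserted and every bounded measurable `F`, `d/dt ∫ F dν_t |_{t=b} = −cov_{ν_b}(F, Re tr U_w/N)` at every real `b`. -/
theorem wilson_singleLoop_hasDerivAt_of_uniform (hball : UniformMassGapOnBallZdG d N β 0 0 0 m A)
    {x : Literature.Probability.LatticeModels.Site d} (w : (zdGraph d).Walk x x)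
    {ν : ℝ → Measure (LGConfig d (SUN N))}
    (hν : ∀ t, ν t ∈ perturbedGibbsMeasures (d := d) (fundamentalRep (Fin N)) (N * β)
      (loopFamilyAction N (fun _ : Unit => (⟨x, w⟩ : ZdLoop d)) (fun _ => t)) (loopSupp (fun _ : Unit => (⟨x, w⟩ : ZdLoop d))))
    {F : LGConfig d (SUN N) → ℝ} (hFm : Measurable F) {C : ℝ} (hFb : ∀ U, |F U| ≤ C) (b : ℝ) :
    HasDerivAt (fun t => ∫ U, F U ∂(ν t)) (-cov[F, loopTerm (d := d) N 1 w; ν b]) b := by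
  classical
  have hmem : MemBallZdG (N := N) (d := d) 0 0 0 0 (fun _ => (∅ : Finset (Finset (ZdEdge d)))) := memBallZdG_zero le_rfl le_rfl 0
  obtain ⟨hVa, hVb, hVs, hT⟩ := singleLoop_data (N := N) w (1 : ℝ)
  have hfam : ∀ t : ℝ, loopFamilyAction (d := d) N (fun _ : Unit => (⟨x, w⟩ : ZdLoop d)) (fun _ => t) =
      0 + t • loopFamilyAction (d := d) N (fun _ : Unit => (⟨x, w⟩ : ZdLoop d)) fun _ => (1 : ℝ) := by
    intro t
    rw [zero_add, ← loopFamilyAction_smul]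
    simp only [mul_one]
  have hν' : ∀ t, ν t ∈ perturbedGibbsMeasures (d := d) (fundamentalRep (Fin N)) (N * β)
      (0 + t • loopFamilyAction (d := d) N (fun _ : Unit => (⟨x, w⟩ : ZdLoop d)) fun _ => (1 : ℝ))
      (fun Λ => (∅ : Finset (Finset (ZdEdge d))) ∪ loopSupp (fun _ : Unit => (⟨x, w⟩ : ZdLoop d)) Λ) := by
    intro t
    have h := hν t
    rw [hfam t] at h
    simpa only [Finset.empty_union] using h
  have key := hasDerivAt_integral_of_uniformMassGapOnBallZdG hball hmem hVa hVb hVs hT hν' hFm hFb b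
  have hH : (fun U : LGConfig d (SUN N) => ∑ A ∈ (Finset.univ : Finset Unit).image
      (fun i => walkEdges ((fun _ : Unit => (⟨x, w⟩ : ZdLoop d)) i).walk),
      loopFamilyAction (d := d) N (fun _ : Unit => (⟨x, w⟩ : ZdLoop d)) (fun _ => (1 : ℝ)) A U) = loopTerm (d := d) N 1 w :=
    funext fun U => sum_singleLoop_source w U
  rw [hH] at key
  exact key

/-- **REAL-ANALYTICITY AT THE WILSON POINT, ONE LOOP OF ANY STRENGTH**: `t ↦ ∫ F dν_t` is real-analytic at every `t₀ ∈ ℝ`. -/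
theorem wilson_singleLoop_analyticAt_of_uniform (hball : UniformMassGapOnBallZdG d N β 0 0 0 m A)
    {x : Literature.Probability.LatticeModels.Site d} (w : (zdGraph d).Walk x x)
    {ν : ℝ → Measure (LGConfig d (SUN N))}
    (hν : ∀ t, ν t ∈ perturbedGibbsMeasures (d := d) (fundamentalRep (Fin N)) (N * β)
      (loopFamilyAction N (fun _ : Unit => (⟨x, w⟩ : ZdLoop d)) (fun _ => t)) (loopSupp (fun _ : Unit => (⟨x, w⟩ : ZdLoop d))))
    {F : LGConfig d (SUN N) → ℝ} (hFm : Measurable F) {C : ℝ} (hFb : ∀ U, |F U| ≤ C) (t₀ : ℝ) :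
    AnalyticAt ℝ (fun t => ∫ U, F U ∂(ν t)) t₀ := by
  classical
  have hmem : MemBallZdG (N := N) (d := d) 0 0 0 0 (fun _ => (∅ : Finset (Finset (ZdEdge d)))) := memBallZdG_zero le_rfl le_rfl 0
  obtain ⟨hVa, hVb, hVs, hT⟩ := singleLoop_data (N := N) w (1 : ℝ)
  have hfam : ∀ t : ℝ, loopFamilyAction (d := d) N (fun _ : Unit => (⟨x, w⟩ : ZdLoop d)) (fun _ => t) =
      0 + t • loopFamilyAction (d := d) N (fun _ : Unit => (⟨x, w⟩ : ZdLoop d)) fun _ => (1 : ℝ) := by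
    intro t
    rw [zero_add, ← loopFamilyAction_smul]
    simp only [mul_one]
  have hν' : ∀ t, ν t ∈ perturbedGibbsMeasures (d := d) (fundamentalRep (Fin N)) (N * β)
      (0 + t • loopFamilyAction (d := d) N (fun _ : Unit => (⟨x, w⟩ : ZdLoop d)) fun _ => (1 : ℝ))
      (fun Λ => (∅ : Finset (Finset (ZdEdge d))) ∪ loopSupp (fun _ : Unit => (⟨x, w⟩ : ZdLoop d)) Λ) := by
    intro t
    have h := hν t
    rw [hfam t] at h
    simpa only [Finset.empty_union] using h
  exact analyticAt_integral_of_uniformMassGapOnBallZdG hball hmem hVa hVb hVs hT hν' hFm hFb t₀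

/-- **THE SUSCEPTIBILITY TO ONE LOOP IS EXPONENTIALLY SMALL IN THE SEPARATION** at the Wilson point of a uniform gauge ball: for the unique
Wilson DLR state `μ`, every selection `ν t` and every Lipschitz cylinder `F` on `Λ_F` disjoint from the links of `w` (`|Λ_F|, |links w| ≤ n`):
`ν 0 = μ` and `|d/dt|_{t=0} ∫ F dν_t| ≤ A n² e^{−m d(Λ_F, w)} (K_F · √N |w| + ‖F‖₂ ‖Re tr U_w/N‖₂)`. -/
theorem wilson_singleLoop_susceptibility_le_of_uniform (hball : UniformMassGapOnBallZdG d N β 0 0 0 m A)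
    {x : Literature.Probability.LatticeModels.Site d} (w : (zdGraph d).Walk x x)
    {μ : Measure (LGConfig d (SUN N))} (hμ : μ ∈ ymGibbsMeasures (d := d) (fundamentalRep (Fin N)) (N * β))
    {ν : ℝ → Measure (LGConfig d (SUN N))}
    (hν : ∀ t, ν t ∈ perturbedGibbsMeasures (d := d) (fundamentalRep (Fin N)) (N * β)
      (loopFamilyAction N (fun _ : Unit => (⟨x, w⟩ : ZdLoop d)) (fun _ => t)) (loopSupp (fun _ : Unit => (⟨x, w⟩ : ZdLoop d))))
    {n : ℕ} {F : LGConfig d (SUN N) → ℝ} {ΛF : Finset (ZdEdge d)} {KF : ℝ≥0}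
    (hF : IsLipschitzCylinder (fundamentalRep (Fin N)) F ΛF KF) (hΛF : ΛF.card ≤ n) (hwn : (walkEdges w).card ≤ n)
    (hdisj : Disjoint ΛF (walkEdges w)) :
    ν 0 = μ ∧ ∃ χ : ℝ, HasDerivAt (fun t => ∫ U, F U ∂(ν t)) χ 0 ∧
      |χ| ≤ A * (n : ℝ) ^ 2 * Real.exp (-m * setDistEdges ΛF (walkEdges w)) *
        ((KF : ℝ) * (|(1 : ℝ)| * Real.sqrt N * w.length) +
          Real.sqrt (∫ U, F U ^ 2 ∂μ) * Real.sqrt (∫ U, loopTerm (d := d) N 1 w U ^ 2 ∂μ)) := by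
  classical
  have hmem : MemBallZdG (N := N) (d := d) 0 0 0 0 (fun _ => (∅ : Finset (Finset (ZdEdge d)))) := memBallZdG_zero le_rfl le_rfl 0
  have h0mem := hball.2 0 _ hmem
  -- `ν 0` is a Wilson DLR state, hence `= μ`
  have huniq := wilson_loops_hasUniqueGibbsMeasure_of_uniform hball (fun _ : Unit => (⟨x, w⟩ : ZdLoop d)) (fun _ => (0 : ℝ))
  have e0 : perturbedGibbsMeasures (d := d) (fundamentalRep (Fin N)) (N * β) 0 (loopSupp (fun _ : Unit => (⟨x, w⟩ : ZdLoop d))) =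
      ymGibbsMeasures (d := d) (fundamentalRep (Fin N)) (N * β) := perturbedGibbsMeasures_zero _ _ _
  have hμ' : μ ∈ perturbedGibbsMeasures (d := d) (fundamentalRep (Fin N)) (N * β)
      (loopFamilyAction N (fun _ : Unit => (⟨x, w⟩ : ZdLoop d)) (fun _ => (0 : ℝ))) (loopSupp (fun _ : Unit => (⟨x, w⟩ : ZdLoop d))) := by
    rw [loopFamilyAction_zero, e0]; exact hμ
  have h0eq : ν 0 = μ := huniq.1 (hν 0) hμ'
  have hder := wilson_singleLoop_hasDerivAt_of_uniform hball w hν hF.measurable hF.abs_le 0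
  rw [h0eq] at hder
  refine ⟨h0eq, _, hder, ?_⟩
  rw [abs_neg]
  have hμ0 : μ ∈ perturbedGibbsMeasures (d := d) (fundamentalRep (Fin N)) (N * β) 0 (fun _ => (∅ : Finset (Finset (ZdEdge d)))) := by
    rw [perturbedGibbsMeasures_zero]; exact hμ
  exact h0mem.2 μ hμ0 n F (loopTerm (d := d) N 1 w) ΛF (walkEdges w) KF _ hΛF hwn hdisj hF (isLipschitzCylinder_loopTerm (N := N) 1 w)

/-- **THE MASS GAP SURVIVES ONE LOOP OF ANY STRENGTH** at the Wilson point of a uniform gauge ball (`m ≥ 0` automatic, `A ≥ 1`): every DLR state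
`ν` of the Wilson action with `t · Re tr U_w/N` inserted satisfies, for Lipschitz cylinders `F`, `G` on disjoint link sets with
`|Λ_F ∪ links w|, |Λ_G ∪ links w| ≤ n`,
`|cov_ν(F, G)| ≤ A n² e^{2|t|} e^{m|w|} e^{−(m/2) d(Λ_F, Λ_G)} (K_F K_G + 2 (|t|√N|w|)(M_F K_G + M_G K_F) + 2 M_F M_G)`. -/
theorem wilson_singleLoop_massGap_of_uniform (hball : UniformMassGapOnBallZdG d N β 0 0 0 m A) (hA : 1 ≤ A)
    {x : Literature.Probability.LatticeModels.Site d} (w : (zdGraph d).Walk x x) (t : ℝ)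
    {ν : Measure (LGConfig d (SUN N))}
    (hν : ν ∈ perturbedGibbsMeasures (d := d) (fundamentalRep (Fin N)) (N * β)
      (loopFamilyAction N (fun _ : Unit => (⟨x, w⟩ : ZdLoop d)) (fun _ => t)) (loopSupp (fun _ : Unit => (⟨x, w⟩ : ZdLoop d))))
    {n : ℕ} {F G : LGConfig d (SUN N) → ℝ} {ΛF ΛG : Finset (ZdEdge d)} {KF KG MF MG : ℝ≥0}
    (hF : IsLipschitzCylinder (fundamentalRep (Fin N)) F ΛF KF) (hMF : ∀ U, |F U| ≤ MF)
    (hG : IsLipschitzCylinder (fundamentalRep (Fin N)) G ΛG KG) (hMG : ∀ U, |G U| ≤ MG)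
    (hn₁ : (ΛF ∪ walkEdges w).card ≤ n) (hn₂ : (ΛG ∪ walkEdges w).card ≤ n) (hdisj : Disjoint ΛF ΛG) :
    |cov[F, G; ν]| ≤ A * (n : ℝ) ^ 2 * exp (2 * |t|) * exp (m * (2 * w.length) / 2) *
        exp (-(m / 2) * setDistEdges ΛF ΛG) *
      ((KF : ℝ) * KG + 2 * (|t| * Real.sqrt N * w.length) * (MF * KG + MG * KF) + 2 * MF * MG) := by
  classical
  have hmem : MemBallZdG (N := N) (d := d) 0 0 0 0 (fun _ => (∅ : Finset (Finset (ZdEdge d)))) := memBallZdG_zero le_rfl le_rfl 0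
  obtain ⟨hVa, hVb, hVs, hT⟩ := singleLoop_data (N := N) w t
  have himg := singleLoop_image (d := d) w
  set Kc : Finset (ZdEdge d) → ℝ≥0 := fun _ => ⟨|t| * Real.sqrt N * w.length, by positivity⟩ with hKc
  have hKcc : ∀ X, (Kc X : ℝ) = |t| * Real.sqrt N * w.length := fun X => by rw [hKc]; rfl
  have hVL : ∀ X ∈ (Finset.univ : Finset Unit).image (fun i => walkEdges ((fun _ : Unit => (⟨x, w⟩ : ZdLoop d)) i).walk),
      IsLipschitzCylinder (fundamentalRep (Fin N)) (loopFamilyAction (d := d) N (fun _ : Unit => (⟨x, w⟩ : ZdLoop d)) (fun _ => t) X)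
        X (Kc X) := by
    intro X hX
    rw [himg, Finset.mem_singleton] at hX
    subst hX
    rw [loopFamilyAction_single_apply]
    exact isLipschitzCylinder_loopTerm (N := N) t w
  have hS : ∀ X ∈ (Finset.univ : Finset Unit).image (fun i => walkEdges ((fun _ : Unit => (⟨x, w⟩ : ZdLoop d)) i).walk),
      X ⊆ walkEdges w := by
    intro X hX
    rw [himg, Finset.mem_singleton] at hX
    exact hX.le
  have hB : ∀ U, |∑ X ∈ (Finset.univ : Finset Unit).image (fun i => walkEdges ((fun _ : Unit => (⟨x, w⟩ : ZdLoop d)) i).walk),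
      loopFamilyAction (d := d) N (fun _ : Unit => (⟨x, w⟩ : ZdLoop d)) (fun _ => t) X U| ≤ |t| := by
    intro U
    rw [himg, Finset.sum_singleton, loopFamilyAction_single_apply]
    exact abs_loopTerm_le w U
  have hδ : ∀ s ∈ walkEdges w, ∀ s' ∈ walkEdges w, ‖s.1 - s'.1‖ ≤ 2 * (w.length : ℝ) := fun s hs s' hs' =>
    norm_sub_le_two_mul_length_of_mem_walkEdges w hs hs'
  have hν' : ν ∈ perturbedGibbsMeasures (d := d) (fundamentalRep (Fin N)) (N * β)
      (0 + loopFamilyAction (d := d) N (fun _ : Unit => (⟨x, w⟩ : ZdLoop d)) fun _ => t)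
      (fun Λ => (∅ : Finset (Finset (ZdEdge d))) ∪ loopSupp (fun _ : Unit => (⟨x, w⟩ : ZdLoop d)) Λ) := by
    simpa only [zero_add, Finset.empty_union] using hν
  have key := abs_cov_le_halfRate_of_uniformMassGapOnBallZdG_add hball hA hmem hVa hVb hVs hT hVL hS hB (by positivity) hδ hν'
    hF hMF hG hMG hn₁ hn₂ hdisj
  have hsum : ((∑ X ∈ (Finset.univ : Finset Unit).image (fun i => walkEdges ((fun _ : Unit => (⟨x, w⟩ : ZdLoop d)) i).walk),
      Kc X : ℝ≥0) : ℝ) = |t| * Real.sqrt N * w.length := by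
    rw [himg, Finset.sum_singleton]; exact hKcc (walkEdges w)
  rw [hsum] at key
  exact key

end Generic

/-! ### Every `N ≥ 2`, `d = 4`, 't Hooft `0 < β < 1/64`: rate `log(1/(64β))`, constant `8N` -/

section SUN

variable {β : ℝ}

/-- **THE WILSON POINT AS A UNIFORM GAUGE BALL, every `N ≥ 2`**: `UniformMassGapOnBallZdG 4 N β 0 0 0 (log(1/(64β))) (8N)` for 't Hooft
`0 < β < 1/64` (the zero member of the hypothesis-free Bakry–Émery weighted ball `suN_uniformBallZdS_rate`). -/
theorem suN_wilson_uniformMassGapOnBallZdG_rate (hN : 2 ≤ N) (h0 : 0 < β) (h : β < 1 / 64) :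
    UniformMassGapOnBallZdG 4 N β 0 0 0 (Real.log (1 / (64 * β))) (8 * N) := by
  have hS := suN_uniformBallZdS_rate hN h0 h
  have ht : 0 ≤ Real.log (1 / (64 * β)) := (Real.log_pos (by rw [lt_div_iff₀ (by positivity)]; linarith)).le
  have hZd : UniformMassGapOnBallZd 4 N β 0 0 ((0 : ℕ) : ℝ) (Real.log (1 / (64 * β))) (8 * N) :=
    hS.uniformMassGapOnBallZd ht (by norm_num) (by simp)
  exact hZd.uniformMassGapOnBallZdG

/-- **Every `N ≥ 2`: finitely many Wilson loops of any strengths create no phase** at 't Hooft `0 < β < 1/64`. -/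
theorem suN_wilson_loops_hasUniqueGibbsMeasure (hN : 2 ≤ N) (h0 : 0 < β) (h : β < 1 / 64) {ι' : Type*} [Fintype ι']
    (γ' : ι' → ZdLoop 4) (c' : ι' → ℝ) :
    HasUniqueGibbsMeasure (perturbedYM (d := 4) (fundamentalRep (Fin N)) (N * β) (loopFamilyAction (d := 4) N γ' c') (loopSupp γ')) :=
  wilson_loops_hasUniqueGibbsMeasure_of_uniform (suN_wilson_uniformMassGapOnBallZdG_rate hN h0 h) γ' c'

/-- **Every `N ≥ 2`: Feynman–Hellmann for one loop of any strength** at 't Hooft `0 < β < 1/64`. -/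
theorem suN_wilson_singleLoop_hasDerivAt (hN : 2 ≤ N) (h0 : 0 < β) (h : β < 1 / 64)
    {x : Literature.Probability.LatticeModels.Site 4} (w : (zdGraph 4).Walk x x)
    {ν : ℝ → Measure (LGConfig 4 (SUN N))}
    (hν : ∀ t, ν t ∈ perturbedGibbsMeasures (d := 4) (fundamentalRep (Fin N)) (N * β)
      (loopFamilyAction N (fun _ : Unit => (⟨x, w⟩ : ZdLoop 4)) (fun _ => t)) (loopSupp (fun _ : Unit => (⟨x, w⟩ : ZdLoop 4))))
    {F : LGConfig 4 (SUN N) → ℝ} (hFm : Measurable F) {C : ℝ} (hFb : ∀ U, |F U| ≤ C) (b : ℝ) :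
    HasDerivAt (fun t => ∫ U, F U ∂(ν t)) (-cov[F, loopTerm (d := 4) N 1 w; ν b]) b :=
  wilson_singleLoop_hasDerivAt_of_uniform (suN_wilson_uniformMassGapOnBallZdG_rate hN h0 h) w hν hFm hFb b

/-- **Every `N ≥ 2`: real-analyticity in the loop coupling** at 't Hooft `0 < β < 1/64`. -/
theorem suN_wilson_singleLoop_analyticAt (hN : 2 ≤ N) (h0 : 0 < β) (h : β < 1 / 64)
    {x : Literature.Probability.LatticeModels.Site 4} (w : (zdGraph 4).Walk x x)
    {ν : ℝ → Measure (LGConfig 4 (SUN N))}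
    (hν : ∀ t, ν t ∈ perturbedGibbsMeasures (d := 4) (fundamentalRep (Fin N)) (N * β)
      (loopFamilyAction N (fun _ : Unit => (⟨x, w⟩ : ZdLoop 4)) (fun _ => t)) (loopSupp (fun _ : Unit => (⟨x, w⟩ : ZdLoop 4))))
    {F : LGConfig 4 (SUN N) → ℝ} (hFm : Measurable F) {C : ℝ} (hFb : ∀ U, |F U| ≤ C) (t₀ : ℝ) :
    AnalyticAt ℝ (fun t => ∫ U, F U ∂(ν t)) t₀ :=
  wilson_singleLoop_analyticAt_of_uniform (suN_wilson_uniformMassGapOnBallZdG_rate hN h0 h) w hν hFm hFb t₀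

/-- **Every `N ≥ 2`: the susceptibility to one loop decays like `(64β)^{d(Λ_F, w)}`**, constant `8N n²`, at 't Hooft `0 < β < 1/64`. -/
theorem suN_wilson_singleLoop_susceptibility_le (hN : 2 ≤ N) (h0 : 0 < β) (h : β < 1 / 64)
    {x : Literature.Probability.LatticeModels.Site 4} (w : (zdGraph 4).Walk x x)
    {μ : Measure (LGConfig 4 (SUN N))} (hμ : μ ∈ ymGibbsMeasures (d := 4) (fundamentalRep (Fin N)) (N * β))
    {ν : ℝ → Measure (LGConfig 4 (SUN N))}
    (hν : ∀ t, ν t ∈ perturbedGibbsMeasures (d := 4) (fundamentalRep (Fin N)) (N * β)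
      (loopFamilyAction N (fun _ : Unit => (⟨x, w⟩ : ZdLoop 4)) (fun _ => t)) (loopSupp (fun _ : Unit => (⟨x, w⟩ : ZdLoop 4))))
    {n : ℕ} {F : LGConfig 4 (SUN N) → ℝ} {ΛF : Finset (ZdEdge 4)} {KF : ℝ≥0}
    (hF : IsLipschitzCylinder (fundamentalRep (Fin N)) F ΛF KF) (hΛF : ΛF.card ≤ n) (hwn : (walkEdges w).card ≤ n)
    (hdisj : Disjoint ΛF (walkEdges w)) :
    ν 0 = μ ∧ ∃ χ : ℝ, HasDerivAt (fun t => ∫ U, F U ∂(ν t)) χ 0 ∧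
      |χ| ≤ 8 * N * (n : ℝ) ^ 2 * Real.exp (-Real.log (1 / (64 * β)) * setDistEdges ΛF (walkEdges w)) *
        ((KF : ℝ) * (|(1 : ℝ)| * Real.sqrt N * w.length) +
          Real.sqrt (∫ U, F U ^ 2 ∂μ) * Real.sqrt (∫ U, loopTerm (d := 4) N 1 w U ^ 2 ∂μ)) :=
  wilson_singleLoop_susceptibility_le_of_uniform (suN_wilson_uniformMassGapOnBallZdG_rate hN h0 h) w hμ hν hF hΛF hwn hdisj

/-- ★ **Every `N ≥ 2`: THE RESPONSE OF ONE WILSON LOOP TO THE INSERTION OF ANOTHER DECAYS EXPONENTIALLY IN THEIR SEPARATION**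
(the connected two-loop correlator as a static susceptibility): for closed walks `w₁`, `w₂` on disjoint link sets of at most `n` links each
and every selection `ν t` of DLR states of the Wilson action with `t · Re tr U_{w₂}/N` inserted,
`|d/dt|_{t=0} ⟨Re tr U_{w₁}/N⟩_{ν_t}| ≤ 8N n² (64β)^{d(w₁, w₂)} (N |w₁| |w₂| + 1)`. -/
theorem suN_wilson_twoLoop_response_le (hN : 2 ≤ N) (h0 : 0 < β) (h : β < 1 / 64)
    {x₁ : Literature.Probability.LatticeModels.Site 4} (w₁ : (zdGraph 4).Walk x₁ x₁)
    {x₂ : Literature.Probability.LatticeModels.Site 4} (w₂ : (zdGraph 4).Walk x₂ x₂)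
    {μ : Measure (LGConfig 4 (SUN N))} (hμ : μ ∈ ymGibbsMeasures (d := 4) (fundamentalRep (Fin N)) (N * β))
    {ν : ℝ → Measure (LGConfig 4 (SUN N))}
    (hν : ∀ t, ν t ∈ perturbedGibbsMeasures (d := 4) (fundamentalRep (Fin N)) (N * β)
      (loopFamilyAction N (fun _ : Unit => (⟨x₂, w₂⟩ : ZdLoop 4)) (fun _ => t)) (loopSupp (fun _ : Unit => (⟨x₂, w₂⟩ : ZdLoop 4))))
    {n : ℕ} (h₁ : (walkEdges w₁).card ≤ n) (h₂ : (walkEdges w₂).card ≤ n) (hdisj : Disjoint (walkEdges w₁) (walkEdges w₂)) :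
    ∃ χ : ℝ, HasDerivAt (fun t => ∫ U, loopTerm (d := 4) N 1 w₁ U ∂(ν t)) χ 0 ∧
      |χ| ≤ 8 * N * (n : ℝ) ^ 2 * Real.exp (-Real.log (1 / (64 * β)) * setDistEdges (walkEdges w₁) (walkEdges w₂)) *
        ((N : ℝ) * w₁.length * w₂.length + 1) := by
  obtain ⟨K₁, hK₁, hF⟩ : ∃ K : ℝ≥0, (K : ℝ) = |(1 : ℝ)| * Real.sqrt N * w₁.length ∧
      IsLipschitzCylinder (fundamentalRep (Fin N)) (loopTerm (d := 4) N 1 w₁) (walkEdges w₁) K :=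
    ⟨_, rfl, isLipschitzCylinder_loopTerm (N := N) 1 w₁⟩
  obtain ⟨-, χ, hχ, hle⟩ := suN_wilson_singleLoop_susceptibility_le hN h0 h w₂ hμ hν hF h₁ h₂ hdisj
  refine ⟨χ, hχ, hle.trans ?_⟩
  haveI : IsProbabilityMeasure μ := IsGibbsMeasure.isProbabilityMeasure hμ
  have hs₁ : Real.sqrt (∫ U, loopTerm (d := 4) N 1 w₁ U ^ 2 ∂μ) ≤ 1 :=
    sqrt_integral_sq_le zero_le_one fun U => (abs_loopTerm_le w₁ U).trans (le_of_eq abs_one)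
  have hs₂ : Real.sqrt (∫ U, loopTerm (d := 4) N 1 w₂ U ^ 2 ∂μ) ≤ 1 :=
    sqrt_integral_sq_le zero_le_one fun U => (abs_loopTerm_le w₂ U).trans (le_of_eq abs_one)
  have hK : (K₁ : ℝ) * (|(1 : ℝ)| * Real.sqrt N * w₂.length) = (N : ℝ) * w₁.length * w₂.length := by
    have hsq : Real.sqrt (N : ℝ) * Real.sqrt N = N := Real.mul_self_sqrt (Nat.cast_nonneg N)
    simp only [hK₁, abs_one, one_mul]
    calc Real.sqrt N * (w₁.length : ℝ) * (Real.sqrt N * w₂.length)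
        = Real.sqrt N * Real.sqrt N * w₁.length * w₂.length := by ring
      _ = (N : ℝ) * w₁.length * w₂.length := by rw [hsq]
  have hC : (0 : ℝ) ≤ 8 * N * (n : ℝ) ^ 2 * Real.exp (-Real.log (1 / (64 * β)) * setDistEdges (walkEdges w₁) (walkEdges w₂)) := by
    positivity
  refine mul_le_mul_of_nonneg_left ?_ hC
  rw [hK]
  exact add_le_add le_rfl ((mul_le_mul hs₁ hs₂ (Real.sqrt_nonneg _) zero_le_one).trans_eq (one_mul 1))

/-- ★ **Every `N ≥ 2`: ONE LOOP OF ANY STRENGTH DOES NOT CLOSE THE MASS GAP** at 't Hooft `0 < β < 1/64` — every DLR state of the perturbed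
action clusters between ANY two Lipschitz cylinders at rate `(1/2) log(1/(64β))`, constant `8N n² e^{2|t|} (64β)^{−|w|} (…)`. -/
theorem suN_wilson_singleLoop_massGap (hN : 2 ≤ N) (h0 : 0 < β) (h : β < 1 / 64)
    {x : Literature.Probability.LatticeModels.Site 4} (w : (zdGraph 4).Walk x x) (t : ℝ)
    {ν : Measure (LGConfig 4 (SUN N))}
    (hν : ν ∈ perturbedGibbsMeasures (d := 4) (fundamentalRep (Fin N)) (N * β)
      (loopFamilyAction N (fun _ : Unit => (⟨x, w⟩ : ZdLoop 4)) (fun _ => t)) (loopSupp (fun _ : Unit => (⟨x, w⟩ : ZdLoop 4))))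
    {n : ℕ} {F G : LGConfig 4 (SUN N) → ℝ} {ΛF ΛG : Finset (ZdEdge 4)} {KF KG MF MG : ℝ≥0}
    (hF : IsLipschitzCylinder (fundamentalRep (Fin N)) F ΛF KF) (hMF : ∀ U, |F U| ≤ MF)
    (hG : IsLipschitzCylinder (fundamentalRep (Fin N)) G ΛG KG) (hMG : ∀ U, |G U| ≤ MG)
    (hn₁ : (ΛF ∪ walkEdges w).card ≤ n) (hn₂ : (ΛG ∪ walkEdges w).card ≤ n) (hdisj : Disjoint ΛF ΛG) :
    |cov[F, G; ν]| ≤ 8 * N * (n : ℝ) ^ 2 * exp (2 * |t|) * exp (Real.log (1 / (64 * β)) * (2 * w.length) / 2) *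
        exp (-(Real.log (1 / (64 * β)) / 2) * setDistEdges ΛF ΛG) *
      ((KF : ℝ) * KG + 2 * (|t| * Real.sqrt N * w.length) * (MF * KG + MG * KF) + 2 * MF * MG) := by
  have hA : (1 : ℝ) ≤ 8 * N := by
    have : (2 : ℝ) ≤ N := by exact_mod_cast hN
    linarith
  exact wilson_singleLoop_massGap_of_uniform (suN_wilson_uniformMassGapOnBallZdG_rate hN h0 h) hA w t hν hF hMF hG hMG hn₁ hn₂ hdisj

end SUN

/-! ### `SU(2)`, `d = 4`, `0 < β_W < 1/8`: rate `log(1/(8β_W))`, constant `16` -/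

section SU2

variable {βW : ℝ}

/-- **THE `SU(2)` WILSON POINT AS A UNIFORM GAUGE BALL AT THE LOGARITHMIC RATE**: `UniformMassGapOnBallZdG 4 2 (β_W/4) 0 0 0 (log(1/(8β_W))) 16`
for `0 < β_W < 1/8` (zero member of `su2_uniformBallZdS_rate`). -/
theorem su2_wilson_uniformMassGapOnBallZdG_rate (h0 : 0 < βW) (h : βW < 1 / 8) :
    UniformMassGapOnBallZdG 4 2 (βW / 4) 0 0 0 (Real.log (1 / (8 * βW))) 16 := by
  have hS := su2_uniformBallZdS_rate (a := 0) (Λ := 0) h0 h (by rw [Real.exp_zero, zero_div, Real.exp_zero]; norm_num)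
  have ht : 0 ≤ Real.log (1 / (8 * βW)) := (Real.log_pos (by rw [lt_div_iff₀ (by positivity)]; linarith)).le
  have hZd : UniformMassGapOnBallZd 4 2 (βW / 4) 0 0 ((0 : ℕ) : ℝ) (Real.log (1 / (8 * βW))) 16 :=
    hS.uniformMassGapOnBallZd ht le_rfl (by simp)
  exact hZd.uniformMassGapOnBallZdG

/-- **`SU(2)`, `0 < β_W < 1/8`: the susceptibility to one loop decays like `(8β_W)^{d(Λ_F, w)}`**, constant `16 n²` (bare coupling `β_W/2`). -/
theorem su2_wilson_singleLoop_susceptibility_le_rate (h0 : 0 < βW) (h : βW < 1 / 8)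
    {x : Literature.Probability.LatticeModels.Site 4} (w : (zdGraph 4).Walk x x)
    {μ : Measure (LGConfig 4 (SUN 2))} (hμ : μ ∈ ymGibbsMeasures (d := 4) (fundamentalRep (Fin 2)) (2 * (βW / 4)))
    {ν : ℝ → Measure (LGConfig 4 (SUN 2))}
    (hν : ∀ t, ν t ∈ perturbedGibbsMeasures (d := 4) (fundamentalRep (Fin 2)) (2 * (βW / 4))
      (loopFamilyAction 2 (fun _ : Unit => (⟨x, w⟩ : ZdLoop 4)) (fun _ => t)) (loopSupp (fun _ : Unit => (⟨x, w⟩ : ZdLoop 4))))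
    {n : ℕ} {F : LGConfig 4 (SUN 2) → ℝ} {ΛF : Finset (ZdEdge 4)} {KF : ℝ≥0}
    (hF : IsLipschitzCylinder (fundamentalRep (Fin 2)) F ΛF KF) (hΛF : ΛF.card ≤ n) (hwn : (walkEdges w).card ≤ n)
    (hdisj : Disjoint ΛF (walkEdges w)) :
    ν 0 = μ ∧ ∃ χ : ℝ, HasDerivAt (fun t => ∫ U, F U ∂(ν t)) χ 0 ∧
      |χ| ≤ 16 * (n : ℝ) ^ 2 * Real.exp (-Real.log (1 / (8 * βW)) * setDistEdges ΛF (walkEdges w)) *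
        ((KF : ℝ) * (|(1 : ℝ)| * Real.sqrt (2 : ℕ) * w.length) +
          Real.sqrt (∫ U, F U ^ 2 ∂μ) * Real.sqrt (∫ U, loopTerm (d := 4) 2 1 w U ^ 2 ∂μ)) :=
  wilson_singleLoop_susceptibility_le_of_uniform (su2_wilson_uniformMassGapOnBallZdG_rate h0 h) w hμ hν hF hΛF hwn hdisj

/-- ★ **`SU(2)`, `0 < β_W < 1/8`: ONE LOOP OF ANY STRENGTH DOES NOT CLOSE THE MASS GAP** — rate `(1/2) log(1/(8β_W))`, constant
`16 n² e^{2|t|} (8β_W)^{−|w|} (…)`. -/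
theorem su2_wilson_singleLoop_massGap_rate (h0 : 0 < βW) (h : βW < 1 / 8)
    {x : Literature.Probability.LatticeModels.Site 4} (w : (zdGraph 4).Walk x x) (t : ℝ)
    {ν : Measure (LGConfig 4 (SUN 2))}
    (hν : ν ∈ perturbedGibbsMeasures (d := 4) (fundamentalRep (Fin 2)) (2 * (βW / 4))
      (loopFamilyAction 2 (fun _ : Unit => (⟨x, w⟩ : ZdLoop 4)) (fun _ => t)) (loopSupp (fun _ : Unit => (⟨x, w⟩ : ZdLoop 4))))
    {n : ℕ} {F G : LGConfig 4 (SUN 2) → ℝ} {ΛF ΛG : Finset (ZdEdge 4)} {KF KG MF MG : ℝ≥0}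
    (hF : IsLipschitzCylinder (fundamentalRep (Fin 2)) F ΛF KF) (hMF : ∀ U, |F U| ≤ MF)
    (hG : IsLipschitzCylinder (fundamentalRep (Fin 2)) G ΛG KG) (hMG : ∀ U, |G U| ≤ MG)
    (hn₁ : (ΛF ∪ walkEdges w).card ≤ n) (hn₂ : (ΛG ∪ walkEdges w).card ≤ n) (hdisj : Disjoint ΛF ΛG) :
    |cov[F, G; ν]| ≤ 16 * (n : ℝ) ^ 2 * exp (2 * |t|) * exp (Real.log (1 / (8 * βW)) * (2 * w.length) / 2) *
        exp (-(Real.log (1 / (8 * βW)) / 2) * setDistEdges ΛF ΛG) *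
      ((KF : ℝ) * KG + 2 * (|t| * Real.sqrt (2 : ℕ) * w.length) * (MF * KG + MG * KF) + 2 * MF * MG) :=
  wilson_singleLoop_massGap_of_uniform (su2_wilson_uniformMassGapOnBallZdG_rate h0 h) (by norm_num) w t hν hF hMF hG hMG hn₁ hn₂ hdisj

end SU2

end Summit.Ventures.YMGap.RobustBall

end
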